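import Summits.QuantumFields.YangMills.Theorems.PencilRigidityNPointIsotropyUnorderedRP
import Summits.QuantumFields.YangMills.Theorems.IsotropyFromPowerCountingCurvatureSandwichBoundChainEngine
import Summits.QuantumFields.YangMills.Theorems.CurvatureSandwichBound.Negative.Unbundled
import HarnessLib

/-!
# `MirrorModularBoosts.SoftKernelBoostCovariance`, line `Sketch`: stub (E) `stub_diagEngine`
# — the diagonal sandwich vector bound from unordered `e₀`-norm growth

Support file for crux stmt-QuantumFields-14999 (`MirrorModularBoosts.SoftKernelBoostCovariance`), line `Sketch`,
stub `stub_diagEngine` (registered text below, lead c13 v3.12).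

Setting. `S₁` is a one-species Schwinger family on `ℝ⁴` with an `e₀`-reconstruction `h` (ordered E2), E3
(`IsSymmetric` on `⁰𝒮`) and the function residual `NPointRegular S₁`; `T := fun n => 𝔖ₙ ∘ (R·)` is its pull-back by
a linear isometry `R`, with ITS OWN `e₀`-reconstruction `h'`. `f` is a windowed one-slot insertion (times in
`[u, 2u]`), `s = 2u + v`, `W` an admissible time-ordered test function and `P ⟨m, G⟩ = ⟨2 + m, T_s (f† ⊗ f ⊗ T_s G)⟩`
the chain step of the landed multiple-reflection engine
`CurvatureSandwichBound.Sketch.sandwich_of_chainGrowth`.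

Statement. If `Λ > 0` and, for all `N ≥ m`, the chain pairing `T(Θ(PᴺW)* ⊗ PᴺW)` equals an `e₀`-pairing
`⟪A, U⟫_{S₁}` of positive-time off-diagonal `A, U` whose unordered norms `Re ⟪A, A⟫_{S₁}`, `Re ⟪U, U⟫_{S₁}` are
`≤ K Λ^{4N}`, then `‖Ψ'_{f ⊗ T_s W}‖ ≤ Λ ‖Ψ'_W‖` (field vectors of `h'`).

Proof.
1. `DiagEngine.osPairing_self_nonneg`: unordered E2 for ONE positive-time off-diagonal entry, `⟪G, G⟫_{S₁} ≥ 0`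
   (real), from the landed `UnorderedRP.sum_osPairing_nonneg` applied to the degree-indexed family with the single
   member `G` (`Function.update 0 d G`).
2. `DiagEngine.norm_osPairing_sq_le`: unordered Cauchy–Schwarz `|⟪A, U⟫|² ≤ Re⟪A, A⟫ · Re⟪U, U⟫`: the Gram form of
   `A + z U` is a nonnegative real for every `z ∈ ℂ` (step 1 + sesquilinearity); `z = 1, i` give hermitian symmetry
   `⟪U, A⟫ = conj ⟪A, U⟫`, `z = -t conj⟪A, U⟫` (`t ∈ ℝ`) a nonnegative real quadratic whose discriminant is `≤ 0`
   (`discrim_le_zero`).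
3. The chain vectors `p_N = Ψ'_{PᴺW}` of `h'` (admissible by `adm_iterate'`) have
   `‖p_N‖² = Re T(Θ(PᴺW)* ⊗ PᴺW)` (`re_pairing_self_eq_norm_sq`) `= Re ⟪A, U⟫ ≤ K Λ^{4N}` for `N ≥ m`, hence
   `‖p_N‖ ≤ C₀ Λ^{2N}` for ALL `N` with `C₀ = √K + ∑_{k<m} ‖p_k‖ Λ^{-2k}`; then
   `Re T(ΘW* ⊗ PᴺW) = Re ⟪p_0, p_N⟫ ≤ ‖p_0‖ C₀ Λ^{2N}` is the chain-growth input of `sandwich_of_chainGrowth`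
   (applied to the family `T` and the reconstruction `h'`), whose conclusion is the claim.

References: K. Osterwalder, R. Schrader, Comm. Math. Phys. 31 (1973) §4.1; 42 (1975) §4; J. Glimm, A. Jaffe,
*Quantum Physics* (2nd ed. 1987), §6.1, §10.5 (Thm 10.5.5). No `def`; helpers in the sub-namespace `DiagEngine`.
-/

noncomputable section

namespace Summit.QuantumFields.YangMills.Theorems.SoftKernelBoostCovariance.Sketch

open scoped BigOperators SchwartzMap InnerProductSpace ComplexConjugate
open MeasureTheory Filter Topology
open Literature.MathematicalPhysics.QuantumLattice Literature.MathematicalPhysics.AQFT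
  Literature.MathematicalPhysics.QuantumFieldTheory
open Summit.QuantumFields.YangMills.Theorems.NPointIsotropy.Negative (E4 NPointRegular)
open Summit.QuantumFields.YangMills.Theorems.NPointIsotropy.QuarterTurnCornerOperator
  (UnorderedRP.sum_osPairing_nonneg)
open Summit.QuantumFields.YangMills.Theorems.CurvatureSandwichBound.Sketch
  (adm_iterate' re_pairing_self_eq_norm_sq sandwich_of_chainGrowth)

namespace DiagEngine

variable {n m : ℕ}

/-! ## Sesquilinearity of the OS pairing (binary forms) -/

/-- The OS pairing with a zero left entry vanishes. -/
theorem osPairing_zero_left (S : SchwingerFamily E4) (G : 𝓢((Fin m → E4), ℂ)) :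
    S.osPairing (0 : 𝓢((Fin n → E4), ℂ)) G = 0 := by
  have h0 : osAdjoint (0 : 𝓢((Fin n → E4), ℂ)) = 0 := by
    ext x
    simp [osAdjoint_apply]
  have h1 : (0 : 𝓢((Fin n → E4), ℂ)).appendTensor G = 0 := by
    ext x
    simp
  rw [SchwingerFamily.osPairing, h0, h1, map_zero]

/-- The OS pairing with a zero right entry vanishes. -/
theorem osPairing_zero_right (S : SchwingerFamily E4) (F : 𝓢((Fin n → E4), ℂ)) :
    S.osPairing F (0 : 𝓢((Fin m → E4), ℂ)) = 0 := by
  have h1 : (osAdjoint F).appendTensor (0 : 𝓢((Fin m → E4), ℂ)) = 0 := by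
    ext x
    simp
  rw [SchwingerFamily.osPairing, h1, map_zero]

/-- Additivity of the OS pairing in the left entry. -/
theorem osPairing_add_left (S : SchwingerFamily E4) (F F' : 𝓢((Fin n → E4), ℂ)) (G : 𝓢((Fin m → E4), ℂ)) :
    S.osPairing (F + F') G = S.osPairing F G + S.osPairing F' G := by
  simp only [SchwingerFamily.osPairing, osAdjoint_add, SchwartzMap.appendTensor_add_left, map_add]

/-- Additivity of the OS pairing in the right entry. -/
theorem osPairing_add_right (S : SchwingerFamily E4) (F : 𝓢((Fin n → E4), ℂ)) (G G' : 𝓢((Fin m → E4), ℂ)) :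
    S.osPairing F (G + G') = S.osPairing F G + S.osPairing F G' := by
  simp only [SchwingerFamily.osPairing, SchwartzMap.appendTensor_add_right, map_add]

/-- Conjugate-homogeneity of the OS pairing in the left entry. -/
theorem osPairing_smul_left (S : SchwingerFamily E4) (c : ℂ) (F : 𝓢((Fin n → E4), ℂ))
    (G : 𝓢((Fin m → E4), ℂ)) : S.osPairing (c • F) G = conj c * S.osPairing F G := by
  simp only [SchwingerFamily.osPairing, osAdjoint_smul, SchwartzMap.appendTensor_smul_left, map_smul,
    smul_eq_mul]

/-- Homogeneity of the OS pairing in the right entry. -/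
theorem osPairing_smul_right (S : SchwingerFamily E4) (c : ℂ) (F : 𝓢((Fin n → E4), ℂ))
    (G : 𝓢((Fin m → E4), ℂ)) : S.osPairing F (c • G) = c * S.osPairing F G := by
  simp only [SchwingerFamily.osPairing, SchwartzMap.appendTensor_smul_right, map_smul, smul_eq_mul]

/-! ## Unordered E2 for one entry and unordered Cauchy–Schwarz -/

/-- **Unordered E2 for ONE entry**: for a one-species family with ordered E2, E3 and the function residual and a
positive-time off-diagonal `G`, `⟪G, G⟫_S` is a nonnegative real (the landed `UnorderedRP.sum_osPairing_nonneg`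
for the degree-indexed family whose only nonzero member is `G`). -/
theorem osPairing_self_nonneg (S : SchwingerFamily E4) (hE2 : S.toLabelled.IsReflectionPositive)
    (hE3 : S.toLabelled.IsSymmetric) (hreg : NPointRegular S) {d : ℕ} (G : 𝓢((Fin d → E4), ℂ))
    (hG : IsPositiveTimeMulti G) (hGo : IsOffDiagonal G) :
    0 ≤ (S.osPairing G G).re ∧ (S.osPairing G G).im = 0 := by
  classical
  obtain ⟨F, hFdef⟩ : ∃ F : (k : ℕ) → 𝓢((Fin k → E4), ℂ),
      F = Function.update (fun k => (0 : 𝓢((Fin k → E4), ℂ))) d G := ⟨_, rfl⟩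
  have hFd : F d = G := by rw [hFdef, Function.update_self]
  have hFk : ∀ k, k ≠ d → F k = 0 := fun k hk => by rw [hFdef, Function.update_of_ne hk]
  have hpos : ∀ k, IsPositiveTimeMulti (F k) := by
    intro k
    by_cases hk : k = d
    · subst hk
      rw [hFd]
      exact hG
    · rw [hFk k hk]
      intro x hx
      simp [tsupport, FunLike.coe_zero] at hx
  have hoff : ∀ k, IsOffDiagonal (F k) := by
    intro k
    by_cases hk : k = d
    · subst hk
      rw [hFd]
      exact hGo
    · rw [hFk k hk]
      exact isOffDiagonal_zero
  have h := UnorderedRP.sum_osPairing_nonneg S hE2 hE3 hreg d F hpos hoff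
  have hd : d ∈ Finset.range (d + 1) := Finset.self_mem_range_succ d
  have hsum : (∑ k ∈ Finset.range (d + 1), ∑ k' ∈ Finset.range (d + 1), S.osPairing (F k) (F k')) =
      S.osPairing G G := by
    rw [Finset.sum_eq_single_of_mem d hd fun k _ hk => ?_]
    · rw [Finset.sum_eq_single_of_mem d hd fun k' _ hk' => ?_, hFd]
      rw [hFk k' hk']
      exact osPairing_zero_right S _
    · rw [hFk k hk]
      exact Finset.sum_eq_zero fun k' _ => osPairing_zero_left S _
  rw [hsum] at h
  exact h

/-- **Unordered Cauchy–Schwarz on `⁰𝒮 ∩ 𝒮₊`**: for positive-time off-diagonal `A, U` of the same degree,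
`|⟪A, U⟫_S|² ≤ Re⟪A, A⟫_S · Re⟪U, U⟫_S`.  The Gram form of `A + zU` is a nonnegative real for all `z ∈ ℂ`
(`osPairing_self_nonneg` + sesquilinearity); `z = 1, i` give `⟪U, A⟫ = conj ⟪A, U⟫`, and `z = -t · conj⟪A, U⟫`
(`t ∈ ℝ`) a nonnegative real quadratic in `t`, whose discriminant is `≤ 0`. -/
theorem norm_osPairing_sq_le (S : SchwingerFamily E4) (hE2 : S.toLabelled.IsReflectionPositive)
    (hE3 : S.toLabelled.IsSymmetric) (hreg : NPointRegular S) {d : ℕ} {A U : 𝓢((Fin d → E4), ℂ)}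
    (hA : IsPositiveTimeMulti A) (hAo : IsOffDiagonal A) (hU : IsPositiveTimeMulti U)
    (hUo : IsOffDiagonal U) :
    ‖S.osPairing A U‖ ^ 2 ≤ (S.osPairing A A).re * (S.osPairing U U).re := by
  -- `A + zU` is positive-time (supports) and off-diagonal
  have hzU : ∀ z : ℂ, IsPositiveTimeMulti (z • U) := fun z =>
    (tsupport_smul_subset_right (fun _ : Fin d → E4 => z) (U : (Fin d → E4) → ℂ)).trans hU
  have hAzU : ∀ z : ℂ, IsPositiveTimeMulti (A + z • U) := fun z =>
    (tsupport_add (A : (Fin d → E4) → ℂ) (z • U)).trans (Set.union_subset hA (hzU z))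
  have hq : ∀ z : ℂ, 0 ≤ (S.osPairing (A + z • U) (A + z • U)).re ∧
      (S.osPairing (A + z • U) (A + z • U)).im = 0 := fun z =>
    osPairing_self_nonneg S hE2 hE3 hreg _ (hAzU z) (hAo.add (hUo.smul z))
  have hexp : ∀ z : ℂ, S.osPairing (A + z • U) (A + z • U) =
      S.osPairing A A + z * S.osPairing A U + conj z * S.osPairing U A +
        conj z * z * S.osPairing U U := by
    intro z
    rw [osPairing_add_left, osPairing_add_right, osPairing_add_right, osPairing_smul_right,
      osPairing_smul_left, osPairing_smul_left, osPairing_smul_right]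
    ring
  have hAA := osPairing_self_nonneg S hE2 hE3 hreg A hA hAo
  have hUU := osPairing_self_nonneg S hE2 hE3 hreg U hU hUo
  set a := S.osPairing A A with ha_def
  set b := S.osPairing A U with hb_def
  set b' := S.osPairing U A with hb'_def
  set r := S.osPairing U U with hr_def
  -- hermitian symmetry from reality at `z = 1` and `z = i`
  have h1 := (hq 1).2
  have hI := (hq Complex.I).2
  rw [hexp] at h1 hI
  simp only [map_one, one_mul, Complex.conj_I, Complex.add_im, Complex.mul_im, Complex.I_re, Complex.I_im,
    Complex.neg_re, Complex.neg_im, Complex.mul_re, zero_mul, one_mul, mul_zero, mul_one, zero_add, add_zero,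
    zero_sub, neg_neg, neg_zero] at h1 hI
  have hb're : b'.re = b.re := by linarith [hAA.2, hUU.2]
  have hb'im : b'.im = -b.im := by linarith [hAA.2, hUU.2]
  -- the real quadratic `t ↦ Re ⟪A - t conj(b) U, A - t conj(b) U⟫`
  set β : ℝ := b.re * b.re + b.im * b.im with hβ_def
  have hβ : ‖b‖ ^ 2 = β := by rw [Complex.sq_norm, Complex.normSq_apply]
  have hquad : ∀ t : ℝ, 0 ≤ β * r.re * (t * t) + -(2 * β) * t + a.re := by
    intro t
    have h0 := (hq (-(t : ℂ) * conj b)).1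
    rw [hexp] at h0
    have key : (a + -(t : ℂ) * conj b * b + conj (-(t : ℂ) * conj b) * b' +
        conj (-(t : ℂ) * conj b) * (-(t : ℂ) * conj b) * r).re =
        β * r.re * (t * t) + -(2 * β) * t + a.re := by
      simp only [map_mul, map_neg, Complex.conj_ofReal, Complex.conj_conj, Complex.add_re, Complex.mul_re,
        Complex.mul_im, Complex.neg_re, Complex.neg_im, Complex.conj_re, Complex.conj_im, Complex.ofReal_re,
        Complex.ofReal_im, hb're, hb'im, hUU.2, hβ_def]
      ring
    rw [key] at h0
    exact h0
  have hdisc := discrim_le_zero hquad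
  rw [discrim] at hdisc
  -- `4β² - 4 β r.re a.re ≤ 0` gives `β ≤ a.re r.re`
  rw [hβ]
  have hβ0 : 0 ≤ β := by rw [hβ_def]; nlinarith
  by_cases hβz : β = 0
  · rw [hβz]
    exact mul_nonneg hAA.1 hUU.1
  · have hβpos : 0 < β := lt_of_le_of_ne hβ0 (Ne.symm hβz)
    nlinarith [hdisc, hβpos, hAA.1, hUU.1]

end DiagEngine

open DiagEngine in
/-- **Stub (E) `stub_diagEngine` — THE DIAGONAL SANDWICH VECTOR BOUND FROM UNORDERED `e₀`-NORM GROWTH** (crux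
`MirrorModularBoosts.SoftKernelBoostCovariance`, stmt-QuantumFields-14999, line `Sketch`; registered text).
For `S₁` with `e₀`-reconstruction `h` (E2), E3 and `NPointRegular S₁`, a pull-back family `T = 𝔖 ∘ (R·)` with
`e₀`-reconstruction `h'`, a windowed insertion `f` (times in `[u, 2u]`), `s = 2u+v`, an admissible `W`, the chain `P`
and a rate `Λ > 0`: IF for all `N ≥ m` the chain pairing `T(Θ(PᴺW)* ⊗ PᴺW)` equals an `e₀`-pairing `⟪A, U⟫_{S₁}` of
positive-time off-diagonal `A, U` whose unordered norms are `≤ K Λ^{4N}`, THEN `‖Ψ'_{f ⊗ T_sW}‖ ≤ Λ‖Ψ'_W‖`.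
Unordered Cauchy–Schwarz (`DiagEngine.norm_osPairing_sq_le`) makes `‖p_N‖² = Re T(Θ(PᴺW)* ⊗ PᴺW) ≤ K Λ^{4N}`
for the chain vectors `p_N = Ψ'_{PᴺW}` (`re_pairing_self_eq_norm_sq`, `adm_iterate'`), a finite sum extends the
growth `‖p_N‖ ≤ C₀ Λ^{2N}` to all `N`, and `Re ⟪p₀, p_N⟫ ≤ ‖p₀‖ ‖p_N‖` feeds the landed engine
`CurvatureSandwichBound.Sketch.sandwich_of_chainGrowth` for the family `T` and the reconstruction `h'`. -/
theorem stub_diagEngine :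
    open Literature.MathematicalPhysics.QuantumLattice Literature.MathematicalPhysics.AQFT
      Literature.MathematicalPhysics.QuantumFieldTheory
      Summit.QuantumFields.YangMills.Theorems.CurvatureSandwichBound.Negative
      Summit.QuantumFields.YangMills.Theorems.NPointIsotropy.Negative in
    ∀ (S₁ : SchwingerFamily E4) (h : OSReconstructionNoE1 S₁.toLabelled),
      S₁.toLabelled.IsSymmetric → NPointRegular S₁ →
    ∀ (R : E4 ≃ₗᵢ[ℝ] E4)
      (h' : OSReconstructionNoE1 (SchwingerFamily.toLabelled (fun n => (S₁ n).comp (linActMulti R)))),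
    ∀ (u v : ℝ), 0 < u → 0 < v → ∀ (f : SchwartzMap (Fin 1 → E4) ℂ),
      tsupport (f : (Fin 1 → E4) → ℂ) ⊆ {x | u ≤ x 0 0 ∧ x 0 0 ≤ 2 * u} →
    ∀ (Λ : ℝ), 0 < Λ → ∀ (n : ℕ) (W : SchwartzMap (Fin n → E4) ℂ) (hW : IsTimeOrdered W)
      (hFW : IsTimeOrdered (f.appendTensor (translateMulti ((2 * u + v) • EuclideanSpace.single 0 1) W))),
    ∀ (P : (Σ m : ℕ, SchwartzMap (Fin m → E4) ℂ) → (Σ m : ℕ, SchwartzMap (Fin m → E4) ℂ)),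
      (P = fun Gσ => ⟨1 + (1 + Gσ.1), translateMulti ((2 * u + v) • EuclideanSpace.single 0 1)
        ((osAdjoint f).appendTensor
          (f.appendTensor (translateMulti ((2 * u + v) • EuclideanSpace.single 0 1) Gσ.2)))⟩) →
      (∃ K : ℝ, 0 ≤ K ∧ ∃ m : ℕ, ∀ N : ℕ, m ≤ N → ∃ (A U : SchwartzMap (Fin (P^[N] ⟨n, W⟩).1 → E4) ℂ),
          IsPositiveTimeMulti A ∧ IsOffDiagonal A ∧ IsPositiveTimeMulti U ∧ IsOffDiagonal U ∧
          (fun n' => (S₁ n').comp (linActMulti R) : SchwingerFamily E4)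
              ((P^[N] ⟨n, W⟩).1 + (P^[N] ⟨n, W⟩).1)
              ((osAdjoint (P^[N] ⟨n, W⟩).2).appendTensor (P^[N] ⟨n, W⟩).2) = S₁.osPairing A U ∧
          (S₁.osPairing A A).re ≤ K * Λ ^ (4 * N) ∧ (S₁.osPairing U U).re ≤ K * Λ ^ (4 * N)) →
      ‖h'.fieldVec (1 + n) (fun _ => ())
          (f.appendTensor (translateMulti ((2 * u + v) • EuclideanSpace.single 0 1) W)) hFW‖ ≤
        Λ * ‖h'.fieldVec n (fun _ => ()) W hW‖ := by
  intro S₁ h hE3 hreg R h' u v hu hv f hf Λ hΛ n W hW hFW P hP hKm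
  obtain ⟨K, hK, m, hm⟩ := hKm
  -- admissibility of every iterate of `⟨n, W⟩`
  have hadm : ∀ k : ℕ, IsTimeOrdered (P^[k] ⟨n, W⟩).2 ∧
      IsTimeOrdered (f.appendTensor
        (translateMulti ((2 * u + v) • EuclideanSpace.single 0 1) (P^[k] ⟨n, W⟩).2)) :=
    fun k => adm_iterate' u v hu hv f hf P hP k ⟨n, W⟩ hW hFW
  -- the chain vectors of `h'`
  let p : ℕ → h'.Hilbert := fun k =>
    h'.fieldVec (P^[k] ⟨n, W⟩).1 (fun _ => ()) (P^[k] ⟨n, W⟩).2 (hadm k).1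
  have hp0 : p 0 = h'.fieldVec n (fun _ => ()) W hW := rfl
  -- growth of the chain vectors beyond `m`: `‖p k‖ ≤ √K Λ^{2k}`
  have hpk : ∀ k, m ≤ k → ‖p k‖ ≤ Real.sqrt K * Λ ^ (2 * k) := by
    intro k hk
    obtain ⟨A, U, hA, hAo, hU, hUo, hAU, hAA, hUU⟩ := hm k hk
    have hsq : ‖p k‖ ^ 2 = (S₁.osPairing A U).re := by
      rw [← re_pairing_self_eq_norm_sq (fun n' => (S₁ n').comp (linActMulti R)) h' _ (hadm k).1]
      exact congrArg Complex.re hAU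
    have hUU0 : 0 ≤ (S₁.osPairing U U).re := (osPairing_self_nonneg S₁ h.reflectionPositive hE3 hreg U hU hUo).1
    have hKΛ : 0 ≤ K * Λ ^ (4 * k) := mul_nonneg hK (pow_nonneg hΛ.le _)
    have h1 : ‖p k‖ ^ 2 ≤ K * Λ ^ (4 * k) := by
      rw [hsq]
      calc (S₁.osPairing A U).re ≤ ‖S₁.osPairing A U‖ := Complex.re_le_norm _
        _ = Real.sqrt (‖S₁.osPairing A U‖ ^ 2) := (Real.sqrt_sq (norm_nonneg _)).symm
        _ ≤ Real.sqrt ((S₁.osPairing A A).re * (S₁.osPairing U U).re) :=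
          Real.sqrt_le_sqrt (norm_osPairing_sq_le S₁ h.reflectionPositive hE3 hreg hA hAo hU hUo)
        _ ≤ Real.sqrt ((K * Λ ^ (4 * k)) * (K * Λ ^ (4 * k))) :=
          Real.sqrt_le_sqrt (mul_le_mul hAA hUU hUU0 hKΛ)
        _ = K * Λ ^ (4 * k) := Real.sqrt_mul_self hKΛ
    calc ‖p k‖ = Real.sqrt (‖p k‖ ^ 2) := (Real.sqrt_sq (norm_nonneg _)).symm
      _ ≤ Real.sqrt (K * Λ ^ (4 * k)) := Real.sqrt_le_sqrt h1
      _ = Real.sqrt K * Λ ^ (2 * k) := by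
        rw [Real.sqrt_mul hK, show Λ ^ (4 * k) = (Λ ^ (2 * k)) ^ 2 by ring,
          Real.sqrt_sq (pow_nonneg hΛ.le _)]
  -- growth of ALL chain vectors: `‖p k‖ ≤ C₀ Λ^{2k}`
  set C₀ : ℝ := Real.sqrt K + ∑ k ∈ Finset.range m, ‖p k‖ / Λ ^ (2 * k) with hC₀_def
  have hterm : ∀ k, 0 ≤ ‖p k‖ / Λ ^ (2 * k) := fun k => div_nonneg (norm_nonneg _) (pow_nonneg hΛ.le _)
  have hsum0 : 0 ≤ ∑ k ∈ Finset.range m, ‖p k‖ / Λ ^ (2 * k) := Finset.sum_nonneg fun k _ => hterm k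
  have hC₀ : 0 ≤ C₀ := add_nonneg (Real.sqrt_nonneg _) hsum0
  have hpC : ∀ k, ‖p k‖ ≤ C₀ * Λ ^ (2 * k) := by
    intro k
    have hΛk : 0 < Λ ^ (2 * k) := pow_pos hΛ _
    by_cases hk : m ≤ k
    · calc ‖p k‖ ≤ Real.sqrt K * Λ ^ (2 * k) := hpk k hk
        _ ≤ C₀ * Λ ^ (2 * k) := mul_le_mul_of_nonneg_right (le_add_of_nonneg_right hsum0) hΛk.le
    · have hkm : k ∈ Finset.range m := Finset.mem_range.2 (lt_of_not_ge hk)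
      have hle : ‖p k‖ / Λ ^ (2 * k) ≤ C₀ :=
        (Finset.single_le_sum (fun j _ => hterm j) hkm).trans (le_add_of_nonneg_left (Real.sqrt_nonneg _))
      calc ‖p k‖ = ‖p k‖ / Λ ^ (2 * k) * Λ ^ (2 * k) := (div_mul_cancel₀ _ hΛk.ne').symm
        _ ≤ C₀ * Λ ^ (2 * k) := mul_le_mul_of_nonneg_right hle hΛk.le
  -- chain moments are the inner products `⟪p 0, p N⟫`
  have hinner : ∀ N : ℕ, ⟪p 0, p N⟫_ℂ =
      (S₁ (n + (P^[N] ⟨n, W⟩).1)).comp (linActMulti R) ((osAdjoint W).appendTensor (P^[N] ⟨n, W⟩).2) :=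
    fun N => h'.inner_fieldVec_fieldVec (fun _ => ()) (fun _ => ()) hW (hadm N).1
      (isAppendTensorOf_appendTensor _ _)
  have hchain : ∀ N : ℕ, ((S₁ (n + (P^[N] ⟨n, W⟩).1)).comp (linActMulti R)
      ((osAdjoint W).appendTensor (P^[N] ⟨n, W⟩).2)).re ≤ ‖p 0‖ * C₀ * Λ ^ (2 * N) := by
    intro N
    rw [← hinner N]
    calc (⟪p 0, p N⟫_ℂ).re ≤ ‖p 0‖ * ‖p N‖ := by
          simpa only [RCLike.re_to_complex] using re_inner_le_norm (𝕜 := ℂ) (p 0) (p N)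
      _ ≤ ‖p 0‖ * (C₀ * Λ ^ (2 * N)) := mul_le_mul_of_nonneg_left (hpC N) (norm_nonneg _)
      _ = ‖p 0‖ * C₀ * Λ ^ (2 * N) := by ring
  exact sandwich_of_chainGrowth (fun n' => (S₁ n').comp (linActMulti R)) h' u v hu hv f hf Λ hΛ.le W hW hFW
    (‖p 0‖ * C₀) (mul_nonneg (norm_nonneg _) hC₀) P hP hchain

end Summit.QuantumFields.YangMills.Theorems.SoftKernelBoostCovariance.Sketch

end
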